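import Summits.AtomisticToContinuum.BoseEinsteinCondensation.Theorems.BECPhaseQuadratureSumRuleSumRuleChainGlueStructure
import Literature.MathematicalPhysics.QuantumManyBody.PeriodicBoseGasThm31
import HarnessLib

/-!
# Route `BECPhaseQuadratureSumRule`, glue `SumRuleChainGlue` (stmt-AtomisticToContinuum-12627) —
# helper: the close-pair count from the sliding-box second moment

The potential part of Puff's cubic moment needs `E_Ψ[#{i<j : |xᵢ - xⱼ - Lm| ≤ R₀ for some m}]`, and the only
positional information in the chain is the crux `LongWaveStructureBound`, a bound on
`∫_cell ∫ (Σⱼ Σ_m 1[xⱼ + Lm ∈ Λ_ℓ(u)])² |Ψ|² dX du`. This file proves the geometric comparison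

  `(ℓ - R₀)³ · Σ_{i<j} Σ_m 1[|xᵢ - xⱼ - Lm| ≤ R₀] ≤ ∫_cell (Σⱼ Σ_m 1[xⱼ + Lm ∈ Λ_ℓ(u)])² du`

for every configuration (`lintegral_boxCount_sq_ge`; the count is the periodic interaction of the indicator
profile `1_{r ≤ R₀}`) and its `|Ψ|²`-average in the order of integration of the crux
(`closePairs_le_boxMoment`). Mechanism: drop the terms `i ≥ j` of the square; for a pair `(i, j)`,
`(Σ_m aₘ)(Σ_{m'} b_{m'}) = Σ_{m₀} Σ_m aₘ b_{m+m₀}`, and `Σ_m ∫_cell aₘ(u) b_{m+m₀}(u) du` unfolds by the tiling of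
`ℝ³` (tree: `tsum_lintegral_cell_sub_latticeVec`) to `|Λ_ℓ(xᵢ) ∩ Λ_ℓ(xⱼ + Lm₀)|`, which contains the box
of side `ℓ - R₀` centred at the midpoint when `|xᵢ - xⱼ - Lm₀| ≤ R₀`.
-/

noncomputable section

open MeasureTheory Filter Set
open scoped ENNReal NNReal Topology BigOperators

namespace Summit.AtomisticToContinuum.BoseEinsteinCondensation.Theorems.SumRuleChainGlue

open Literature.MathematicalPhysics.QuantumManyBody.BoseGas

variable {N : ℕ} {L ℓ R₀ : ℝ}

/-! ### Box geometry -/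

/-- **Two boxes of side `ℓ` whose centres are within `R₀ ≤ ℓ` share a box of side `ℓ - R₀`** (centred at the
midpoint). -/
theorem slidingBox_midpoint_subset {c c' : Space} (hcc : ‖c - c'‖ ≤ R₀) :
    slidingBox (ℓ - R₀) ((2 : ℝ)⁻¹ • (c + c')) ⊆ slidingBox ℓ c ∩ slidingBox ℓ c' := by
  intro u hu
  have hk : ∀ k, |c k - c' k| ≤ R₀ := fun k => by
    have h1 : (c - c') k ^ 2 ≤ ‖c - c'‖ ^ 2 := by
      rw [EuclideanSpace.real_norm_sq_eq]
      exact Finset.single_le_sum (fun i _ => sq_nonneg ((c - c') i)) (Finset.mem_univ k)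
    have h2 := Real.sqrt_le_sqrt h1
    rw [Real.sqrt_sq_eq_abs, Real.sqrt_sq (norm_nonneg _), PiLp.sub_apply] at h2
    exact h2.trans hcc
  constructor
  · intro k
    have h := hu k
    simp only [PiLp.smul_apply, PiLp.add_apply, smul_eq_mul, Set.mem_Icc] at h ⊢
    have := hk k
    rw [abs_le] at this
    constructor <;> nlinarith [h.1, h.2, this.1, this.2]
  · intro k
    have h := hu k
    simp only [PiLp.smul_apply, PiLp.add_apply, smul_eq_mul, Set.mem_Icc] at h ⊢
    have := hk k
    rw [abs_le] at this
    constructor <;> nlinarith [h.1, h.2, this.1, this.2]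

/-- The volume of the intersection of two close boxes: `(ℓ - R₀)³ ≤ |Λ_ℓ(c) ∩ Λ_ℓ(c')|` if `|c - c'| ≤ R₀ ≤ ℓ`. -/
theorem volume_inter_slidingBox_ge (hRℓ : R₀ ≤ ℓ) {c c' : Space} (hcc : ‖c - c'‖ ≤ R₀) :
    ENNReal.ofReal ((ℓ - R₀) ^ 3) ≤ volume (slidingBox ℓ c ∩ slidingBox ℓ c') := by
  calc ENNReal.ofReal ((ℓ - R₀) ^ 3) = volume (slidingBox (ℓ - R₀) ((2 : ℝ)⁻¹ • (c + c'))) := by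
        rw [volume_slidingBox, ENNReal.ofReal_pow (sub_nonneg.2 hRℓ)]
    _ ≤ volume (slidingBox ℓ c ∩ slidingBox ℓ c') := measure_mono (slidingBox_midpoint_subset hcc)

/-! ### One pair: tiling -/

/-- **One pair and one image.** For `xᵢ, y ∈ ℝ³`:
`Σ_m ∫_cell 1[xᵢ + Lm ∈ Λ_ℓ(u)] · 1[y + Lm ∈ Λ_ℓ(u)] du = |Λ_ℓ(xᵢ) ∩ Λ_ℓ(y)|` (tiling of `ℝ³`). -/
theorem tsum_lintegral_indicator_mul_indicator (hL : 0 < L) (ℓ : ℝ) (x y : Space) :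
    ∑' m : Fin 3 → ℤ, ∫⁻ u in cell L, (slidingBox ℓ u).indicator (fun _ => (1 : ℝ≥0∞)) (x + latticeVec L m) *
        (slidingBox ℓ u).indicator (fun _ => (1 : ℝ≥0∞)) (y + latticeVec L m) =
      volume (slidingBox ℓ x ∩ slidingBox ℓ y) := by
  set h : Space → ℝ≥0∞ := (slidingBox ℓ x ∩ slidingBox ℓ y).indicator fun _ => (1 : ℝ≥0∞) with hh
  have hpt : ∀ (m : Fin 3 → ℤ) (u : Space),
      (slidingBox ℓ u).indicator (fun _ => (1 : ℝ≥0∞)) (x + latticeVec L m) *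
        (slidingBox ℓ u).indicator (fun _ => (1 : ℝ≥0∞)) (y + latticeVec L m) = h (u - latticeVec L m) := by
    intro m u
    have e1 : x + latticeVec L m ∈ slidingBox ℓ u ↔ u - latticeVec L m ∈ slidingBox ℓ x := by
      rw [add_latticeVec_mem_slidingBox_iff, mem_slidingBox_comm]
    have e2 : y + latticeVec L m ∈ slidingBox ℓ u ↔ u - latticeVec L m ∈ slidingBox ℓ y := by
      rw [add_latticeVec_mem_slidingBox_iff, mem_slidingBox_comm]
    by_cases hx : u - latticeVec L m ∈ slidingBox ℓ x
    · by_cases hy : u - latticeVec L m ∈ slidingBox ℓ y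
      · rw [Set.indicator_of_mem (e1.2 hx), Set.indicator_of_mem (e2.2 hy), hh,
          Set.indicator_of_mem (Set.mem_inter hx hy), mul_one]
      · rw [Set.indicator_of_notMem (show y + latticeVec L m ∉ slidingBox ℓ u from fun h => hy (e2.1 h)), mul_zero,
          hh, Set.indicator_of_notMem (show u - latticeVec L m ∉ slidingBox ℓ x ∩ slidingBox ℓ y from fun h => hy h.2)]
    · rw [Set.indicator_of_notMem (show x + latticeVec L m ∉ slidingBox ℓ u from fun h => hx (e1.1 h)), zero_mul,
        hh, Set.indicator_of_notMem (show u - latticeVec L m ∉ slidingBox ℓ x ∩ slidingBox ℓ y from fun h => hx h.1)]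
  simp only [hpt]
  rw [tsum_lintegral_cell_sub_latticeVec hL h, hh, lintegral_indicator
    ((measurableSet_slidingBox ℓ x).inter (measurableSet_slidingBox ℓ y)), setLIntegral_const, one_mul]

/-- Measurability in `u` of the box indicator at a fixed point. -/
theorem measurable_boxIndicator (ℓ : ℝ) (z : Space) :
    Measurable fun u : Space => (slidingBox ℓ u).indicator (fun _ => (1 : ℝ≥0∞)) z := by
  have hset : MeasurableSet {u : Space | z ∈ slidingBox ℓ u} := by
    have : {u : Space | z ∈ slidingBox ℓ u} = slidingBox ℓ z := by
      ext u; exact mem_slidingBox_comm ℓ u z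
    rw [this]; exact measurableSet_slidingBox ℓ z
  have : (fun u : Space => (slidingBox ℓ u).indicator (fun _ => (1 : ℝ≥0∞)) z) =
      {u : Space | z ∈ slidingBox ℓ u}.indicator fun _ => (1 : ℝ≥0∞) := by
    funext u
    by_cases h : z ∈ slidingBox ℓ u
    · rw [Set.indicator_of_mem h, Set.indicator_of_mem (show u ∈ {u : Space | z ∈ slidingBox ℓ u} from h)]
    · rw [Set.indicator_of_notMem h, Set.indicator_of_notMem (show u ∉ {u : Space | z ∈ slidingBox ℓ u} from h)]
  rw [this]
  exact measurable_const.indicator hset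

/-- **One pair, all images**: `(ℓ - R₀)³ Σ_m 1[|xᵢ - xⱼ - Lm| ≤ R₀] ≤ ∫_cell gᵢ(u) gⱼ(u) du` with
`gⱼ(u) = Σ_m 1[xⱼ + Lm ∈ Λ_ℓ(u)]`. -/
theorem pair_count_le_lintegral (hL : 0 < L) (hRℓ : R₀ ≤ ℓ) (xi xj : Space) :
    ENNReal.ofReal ((ℓ - R₀) ^ 3) * periodizedPotential ((Set.Iic R₀).indicator fun _ => (1 : ℝ≥0∞)) L (xi - xj) ≤
      ∫⁻ u in cell L, (∑' m : Fin 3 → ℤ, (slidingBox ℓ u).indicator (fun _ => (1 : ℝ≥0∞)) (xi + latticeVec L m)) *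
        ∑' m : Fin 3 → ℤ, (slidingBox ℓ u).indicator (fun _ => (1 : ℝ≥0∞)) (xj + latticeVec L m) := by
  set a : (Fin 3 → ℤ) → Space → ℝ≥0∞ := fun m u => (slidingBox ℓ u).indicator (fun _ => (1 : ℝ≥0∞)) (xi + latticeVec L m)
    with ha
  set b : (Fin 3 → ℤ) → Space → ℝ≥0∞ := fun m u => (slidingBox ℓ u).indicator (fun _ => (1 : ℝ≥0∞)) (xj + latticeVec L m)
    with hb
  -- reindex the product of the two lattice sums
  have hprod : ∀ u, (∑' m, a m u) * (∑' m, b m u) = ∑' m₀, ∑' m, a m u * b (m + m₀) u := by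
    intro u
    rw [← ENNReal.tsum_mul_right]
    have h1 : ∀ m, a m u * ∑' m', b m' u = ∑' m₀, a m u * b (m + m₀) u := by
      intro m
      rw [← ENNReal.tsum_mul_left, ← (Equiv.addLeft m).tsum_eq (fun m' => a m u * b m' u)]
      rfl
    simp only [h1]
    exact ENNReal.tsum_comm
  show _ ≤ ∫⁻ u in cell L, (∑' m, a m u) * ∑' m, b m u
  simp only [hprod]
  have hmeas : ∀ m₀ m, Measurable fun u => a m u * b (m + m₀) u := fun m₀ m =>
    (measurable_boxIndicator ℓ _).mul (measurable_boxIndicator ℓ _)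
  rw [lintegral_tsum fun m₀ => (Measurable.tsum fun m => hmeas m₀ m).aemeasurable]
  simp only [lintegral_tsum fun m => (hmeas _ m).aemeasurable]
  -- each image `m₀`: tiling gives the intersection volume
  have himage : ∀ m₀ : Fin 3 → ℤ, ∑' m, ∫⁻ u in cell L, a m u * b (m + m₀) u =
      volume (slidingBox ℓ xi ∩ slidingBox ℓ (xj + latticeVec L m₀)) := by
    intro m₀
    have h := tsum_lintegral_indicator_mul_indicator hL ℓ xi (xj + latticeVec L m₀)
    refine Eq.trans (tsum_congr fun m => lintegral_congr fun u => ?_) h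
    simp only [ha, hb, latticeVec_add, add_assoc, add_comm (latticeVec L m₀)]
  simp only [himage]
  -- compare termwise with the count
  rw [periodizedPotential, ← ENNReal.tsum_mul_left]
  refine ENNReal.tsum_le_tsum fun m₀ => ?_
  by_cases hclose : ‖xi - xj - latticeVec L m₀‖ ≤ R₀
  · rw [Set.indicator_of_mem (Set.mem_Iic.2 hclose), mul_one]
    exact volume_inter_slidingBox_ge hRℓ (by rwa [← sub_sub])
  · rw [Set.indicator_of_notMem (fun h => hclose (Set.mem_Iic.1 h)), mul_zero]
    exact bot_le

/-! ### All pairs -/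

/-- **The close-pair count of a configuration is controlled by the box second moment**:
`(ℓ - R₀)³ · Σ_{i<j} Σ_m 1[|xᵢ - xⱼ - Lm| ≤ R₀] ≤ ∫_cell (Σⱼ Σ_m 1[xⱼ + Lm ∈ Λ_ℓ(u)])² du`. -/
theorem lintegral_boxCount_sq_ge (hL : 0 < L) (hRℓ : R₀ ≤ ℓ) (X : Config N) :
    ENNReal.ofReal ((ℓ - R₀) ^ 3) * periodicInteraction ((Set.Iic R₀).indicator fun _ => (1 : ℝ≥0∞)) L X ≤
      ∫⁻ u in cell L, (∑ j : Fin N, ∑' m : Fin 3 → ℤ,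
        (slidingBox ℓ u).indicator (fun _ => (1 : ℝ≥0∞)) (X j + latticeVec L m)) ^ 2 := by
  set g : Fin N → Space → ℝ≥0∞ := fun j u => ∑' m : Fin 3 → ℤ,
    (slidingBox ℓ u).indicator (fun _ => (1 : ℝ≥0∞)) (X j + latticeVec L m) with hg
  have hgm : ∀ j, Measurable (g j) := fun j => Measurable.tsum fun m => measurable_boxIndicator ℓ _
  -- the count, pair by pair
  calc ENNReal.ofReal ((ℓ - R₀) ^ 3) * periodicInteraction ((Set.Iic R₀).indicator fun _ => (1 : ℝ≥0∞)) L X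
      = ∑ i : Fin N, ∑ j : Fin N with i < j, ENNReal.ofReal ((ℓ - R₀) ^ 3) *
          periodizedPotential ((Set.Iic R₀).indicator fun _ => (1 : ℝ≥0∞)) L (X i - X j) := by
        rw [periodicInteraction, Finset.mul_sum]
        exact Finset.sum_congr rfl fun i _ => Finset.mul_sum _ _ _
    _ ≤ ∑ i : Fin N, ∑ j : Fin N with i < j, ∫⁻ u in cell L, g i u * g j u :=
        Finset.sum_le_sum fun i _ => Finset.sum_le_sum fun j _ => pair_count_le_lintegral hL hRℓ (X i) (X j)
    _ ≤ ∑ i : Fin N, ∑ j : Fin N, ∫⁻ u in cell L, g i u * g j u :=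
        Finset.sum_le_sum fun i _ => Finset.sum_le_sum_of_subset_of_nonneg (Finset.filter_subset _ _)
          fun j _ _ => bot_le
    _ = ∫⁻ u in cell L, ∑ i : Fin N, ∑ j : Fin N, g i u * g j u := by
        have hm : ∀ i : Fin N, Measurable fun u => ∑ j : Fin N, g i u * g j u := fun i =>
          Finset.measurable_sum _ fun j _ => (hgm i).mul (hgm j)
        have hm' : ∀ i j : Fin N, Measurable fun u => g i u * g j u := fun i j => (hgm i).mul (hgm j)
        rw [lintegral_finsetSum _ fun i _ => hm i]
        refine Finset.sum_congr rfl fun i _ => ?_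
        rw [lintegral_finsetSum _ fun j _ => hm' i j]
    _ = ∫⁻ u in cell L, (∑ j : Fin N, g j u) ^ 2 := by
        refine lintegral_congr fun u => ?_
        rw [sq, Finset.sum_mul_sum]

/-- **The expected close-pair count is controlled by the averaged box second moment** (the quantity bounded
by `LongWaveStructureBound`), in its order of integration:
`(ℓ - R₀)³ · E_Ψ[Σ_{i<j} Σ_m 1[|xᵢ - xⱼ - Lm| ≤ R₀]] ≤ ∫_cell ∫ (Σⱼ Σ_m 1[xⱼ + Lm ∈ Λ_ℓ(u)])² |Ψ|² dX du`. -/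
theorem closePairs_le_boxMoment (hL : 0 < L) (hRℓ : R₀ ≤ ℓ) (Ψ : PeriodicTrialState N L) :
    ENNReal.ofReal ((ℓ - R₀) ^ 3) *
        ∫⁻ X in cellN N L, periodicInteraction ((Set.Iic R₀).indicator fun _ => (1 : ℝ≥0∞)) L X *
          (‖Ψ.ψ X‖₊ : ℝ≥0∞) ^ 2 ≤
      ∫⁻ u in cell L, ∫⁻ X in cellN N L, (∑ j : Fin N, ∑' m : Fin 3 → ℤ,
        (slidingBox ℓ u).indicator (fun _ => (1 : ℝ≥0∞)) (X j + latticeVec L m)) ^ 2 * (‖Ψ.ψ X‖₊ : ℝ≥0∞) ^ 2 := by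
  have hF : Measurable fun q : Space × Config N => (∑ j : Fin N, ∑' m : Fin 3 → ℤ,
      (slidingBox ℓ q.1).indicator (fun _ => (1 : ℝ≥0∞)) (q.2 j + latticeVec L m)) ^ 2 * (‖Ψ.ψ q.2‖₊ : ℝ≥0∞) ^ 2 :=
    ((measurable_boxCount' ℓ L).pow_const 2).mul (Ψ.measurable_normSq.comp measurable_snd)
  rw [lintegral_lintegral_swap (hF.aemeasurable (μ := (volume.restrict (cell L)).prod (volume.restrict (cellN N L)))),
    ← lintegral_const_mul' _ _ ENNReal.ofReal_ne_top]
  refine lintegral_mono fun X => ?_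
  rw [← mul_assoc, lintegral_mul_const' _ _ (ENNReal.pow_ne_top ENNReal.coe_ne_top)]
  exact mul_le_mul_of_nonneg_right (lintegral_boxCount_sq_ge hL hRℓ X) bot_le

end Summit.AtomisticToContinuum.BoseEinsteinCondensation.Theorems.SumRuleChainGlue

end
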